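import Literature.NumberTheory.Automorphic.UnitaryGroupLineBorelModulus          -- ★ `LineRing.distribHaarChar_torus_two`, `LineRing.torus_relations_two` (via import)
import Literature.NumberTheory.Automorphic.UnitaryGroupPrincipalSeriesExponents  -- ★ `weylTorusCharPair`, `conjInvChar`
import Literature.NumberTheory.Automorphic.UnitaryGroupGlobalGenericity          -- ★ `StdForm.antidiagonal_over_apply`
import HarnessLib

/-!
# The Weyl conjugate of a torus element of `U(σ, Φ₂)`: `w₀ d(α, ᾱ⁻¹) w₀⁻¹ = d(ᾱ⁻¹, α)`, and `χ(ʷt) = (wχ)(t)` — the `N = 2` twin of ★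
# `CMBorelWeylTorusConjugate` (the rank-one quasi-split unitary group `U(1,1)`, i.e. the `U(Φ₂)`-factor of `H = U(2) × U(1)`)

Topic `NumberTheory/Automorphic`; namespace `Literature.NumberTheory.Automorphic.UnitaryGroup`.  THEOREMS ONLY: no definition, no named fact, no
`sorry`, no instance, no notation.  Cell `pub/hodgecm-mathlib`, crux H413 (`stmt-HodgeConjecture-24833`), line LH6 «StCharTS» road (D) slice (D-b) ∕ F1-H
(the Jacquet filtration of `i_{U(Φ₂)}(χ)`, [Casselman1995, L. 7.1.1 (a)] at `N = 2`): the TORUS ALGEBRA of the scalar check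
`δ^{-1∕2}(t) · (χ·δ^{1∕2})(ʷt) · Δ_{B₂}(t) = wχ(t)` (brick (γ-W)₂), token-parallel to the `N = 3` file.

## The mathematics ([Rogawski1990, §1.10 p. 9, §12.1 p. 171]; [Casselman1995, §6.4])

`R` a commutative ring with involution `σ`, `J = Φ₂` the antidiagonal form, `U = U(σ, Φ₂)(R)` (★ `unitaryGroupOfForm`), `T ≤ B ≤ U` the diagonal torus
and the Borel (★ `torusU`, `borelU`), `w₀ ∈ U` any element whose MATRIX IS `Φ₂`.  For `t = diag(d₀, d₁) ∈ T` (`σ(d₀) d₁ = 1`, ★ `LineRing.torus_relations_two`):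
* `coe_weyl_mul_glDiagonal_two` — `w₀ · diag(d) = diag(d ∘ rev) · w₀`, so `ʷt := w₀ t w₀⁻¹ = diag(d₁, d₀) ∈ T` (`weylConj_mem_two`,
  `glDiagonal_rev_eq_weylConj_two`, `weylConj_mem_two`), `ʷt ∈ B` with `proj(ʷt) = ʷt` (`proj_weylConj_two`);
* `torusEntry_zero_weylConj_two` — `(ʷt)₀₀ = d₁ = σ(d₀)⁻¹`; `torusDetNormOne_weylConj_two` — `det ʷt = det t`;
* **`torusCharPair_weylConj_two`** — `χ(ʷt) = (wχ)(t)` for `χ = (χ₁, χ₂)` (★ `torusCharPair`, coordinate `0`) and `wχ = (χ̄₁⁻¹, χ₂)` (★ `weylTorusCharPair`);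
* `unitModulusChar_torusEntry_zero_weylConj_two` — `‖(ʷt)₀₀‖ = ‖t₀₀‖⁻¹` (★ `LineRing.distribHaarChar_torus_two`);
* §2 the CM instance (`R = ∏_{w∣v} L_w`, `σ = c ⊗ 1`, `J = cmLocalForm L 2 v`).
HONEST LABEL: HC_CM is proved only modulo the 7 printed citations (2 remaining: hLiu418 = stmt-HodgeConjecture-24832, h413 = stmt-HodgeConjecture-24833)
until rung 0 closes; this file is count-neutral vocabulary-level algebra.

## References
* [Rogawski1990] J. D. Rogawski, *Automorphic Representations of Unitary Groups in Three Variables* (1990), §1.10 p. 9, §12.1 p. 171 («`w(χ₁, χ₂) = (χ̄₁⁻¹, χ₂)`»).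
* [Casselman1995] W. Casselman, *Introduction to the theory of admissible representations of `p`-adic reductive groups* (1995), §6.4, L. 7.1.1.
-/

set_option autoImplicit false

noncomputable section

open scoped MatrixGroups NNReal
open MeasureTheory

namespace Literature.NumberTheory.Automorphic

namespace UnitaryGroup

/-! ## §1 Generic ring `R` with involution, `J = Φ₂`, `w₀` the element with matrix `Φ₂` -/

section Generic

variable {R : Type*} [CommRing R] (σ : R →+* R) {J : Matrix (Fin 2) (Fin 2) R} (hJ : J = (StdForm.antidiagonal 2).over R)
  (w₀ : ↥(unitaryGroupOfForm σ J)) (hw₀ : ((w₀ : GL (Fin 2) R) : Matrix (Fin 2) (Fin 2) R) = J)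

include hJ hw₀ in
/-- **`w₀ · diag(d) = diag(d ∘ rev) · w₀`** in `GL₂(R)` for the antidiagonal `w₀ = Φ₂`. [cite: Rogawski1990, §1.10 p. 9] -/
theorem coe_weyl_mul_glDiagonal_two (d : Fin 2 → Rˣ) :
    (w₀ : GL (Fin 2) R) * glDiagonal 2 R d = glDiagonal 2 R (fun i => d i.rev) * (w₀ : GL (Fin 2) R) := by
  refine Matrix.GeneralLinearGroup.ext fun i j => ?_
  rw [Units.val_mul, Units.val_mul, coe_glDiagonal, coe_glDiagonal, Matrix.mul_diagonal, Matrix.diagonal_mul, hw₀, hJ,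
    StdForm.antidiagonal_over_apply]
  by_cases hij : j = i.rev
  · subst hij
    rw [if_pos rfl, one_mul, mul_one]
  · rw [if_neg hij, zero_mul, mul_zero]

include hJ hw₀ in
/-- `w₀ · diag(d) · w₀⁻¹ = diag(d ∘ rev)` in `GL₂(R)`. [cite: Rogawski1990, §1.10 p. 9] -/
theorem weyl_mul_glDiagonal_mul_inv_two (d : Fin 2 → Rˣ) :
    (w₀ : GL (Fin 2) R) * glDiagonal 2 R d * (w₀ : GL (Fin 2) R)⁻¹ = glDiagonal 2 R (fun i => d i.rev) := by
  rw [coe_weyl_mul_glDiagonal_two σ hJ w₀ hw₀ d, mul_inv_cancel_right]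

include hJ hw₀ in
/-- **`ʷt := w₀ t w₀⁻¹ ∈ T ≤ B`** for `t ∈ T` (both memberships at once). [cite: Rogawski1990, §1.10 p. 9] -/
theorem weylConj_mem_two (t : ↥(torusU σ J)) :
    w₀ * (t : ↥(unitaryGroupOfForm σ J)) * w₀⁻¹ ∈ torusU σ J ∧ w₀ * (t : ↥(unitaryGroupOfForm σ J)) * w₀⁻¹ ∈ borelU σ J := by
  obtain ⟨d, hd⟩ := (mem_torusU_iff _).1 t.2
  have hT : w₀ * (t : ↥(unitaryGroupOfForm σ J)) * w₀⁻¹ ∈ torusU σ J := by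
    refine (mem_torusU_iff _).2 ⟨fun i => d i.rev, ?_⟩
    rw [Subgroup.coe_mul, Subgroup.coe_mul, Subgroup.coe_inv, ← hd, weyl_mul_glDiagonal_mul_inv_two σ hJ w₀ hw₀ d]
  exact ⟨hT, torusU_le_borelU σ J hT⟩

include hJ hw₀ in
/-- the diagonal of `ʷt` is the reversed diagonal of `t`: `diag(d ∘ rev) = ʷt`. [cite: Rogawski1990, §1.10 p. 9] -/
theorem glDiagonal_rev_eq_weylConj_two (t : ↥(torusU σ J)) {d : Fin 2 → Rˣ}
    (hd : glDiagonal 2 R d = ((t : ↥(unitaryGroupOfForm σ J)) : GL (Fin 2) R)) :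
    glDiagonal 2 R (fun i => d i.rev) =
      (((⟨w₀ * (t : ↥(unitaryGroupOfForm σ J)) * w₀⁻¹, (weylConj_mem_two σ hJ w₀ hw₀ t).1⟩ : ↥(torusU σ J)) :
        ↥(unitaryGroupOfForm σ J)) : GL (Fin 2) R) := by
  change glDiagonal 2 R (fun i => d i.rev) = ((w₀ * (t : ↥(unitaryGroupOfForm σ J)) * w₀⁻¹ : ↥(unitaryGroupOfForm σ J)) : GL (Fin 2) R)
  rw [Subgroup.coe_mul, Subgroup.coe_mul, Subgroup.coe_inv, ← hd, weyl_mul_glDiagonal_mul_inv_two σ hJ w₀ hw₀ d]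

include hw₀ in
/-- **The Levi projection fixes `ʷt`**: `proj ⟨ʷt, _⟩ = ⟨ʷt, _⟩` (★ `ParabolicTriple.proj_apply_of_mem_M`). [cite: BernsteinZelevinsky1977, §1.8] -/
theorem proj_weylConj_two (t : ↥(torusU σ J)) :
    (borelTriple σ J hJ).proj ⟨w₀ * (t : ↥(unitaryGroupOfForm σ J)) * w₀⁻¹, (weylConj_mem_two σ hJ w₀ hw₀ t).2⟩ =
      ⟨w₀ * (t : ↥(unitaryGroupOfForm σ J)) * w₀⁻¹, (weylConj_mem_two σ hJ w₀ hw₀ t).1⟩ :=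
  Subtype.ext ((borelTriple σ J hJ).proj_apply_of_mem_M _ (weylConj_mem_two σ hJ w₀ hw₀ t).1)

include hw₀ in
/-- **`(ʷt)₀₀ = σ(t₀₀)⁻¹`** (`(ʷt)₀₀ = d₁` and the torus relation `σ(d₀) d₁ = 1`, ★ `LineRing.torus_relations_two`). [cite: Rogawski1990, §1.10 p. 9] -/
theorem torusEntry_zero_weylConj_two (t : ↥(torusU σ J)) :
    torusEntry σ J 0 ⟨w₀ * (t : ↥(unitaryGroupOfForm σ J)) * w₀⁻¹, (weylConj_mem_two σ hJ w₀ hw₀ t).1⟩ =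
      (Units.map (σ : R →* R) (torusEntry σ J 0 t))⁻¹ := by
  obtain ⟨d, hd⟩ := (mem_torusU_iff _).1 t.2
  rw [torusEntry_eq_of_glDiagonal_eq σ J 0 _ _ (glDiagonal_rev_eq_weylConj_two σ hJ w₀ hw₀ t hd),
    torusEntry_eq_of_glDiagonal_eq σ J 0 t d hd]
  obtain ⟨-, h01⟩ := LineRing.torus_relations_two σ hJ t hd
  have hu : Units.map (σ : R →* R) (d 0) * d 1 = 1 :=
    Units.ext (by rw [Units.val_mul, Units.coe_map, MonoidHom.coe_coe, Units.val_one]; exact h01)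
  exact (eq_inv_of_mul_eq_one_right hu)

include hw₀ in
/-- **`det ʷt = det t`** (as elements of `E¹`). [cite: Rogawski1990, §12.1 p. 171] -/
theorem torusDetNormOne_weylConj_two (t : ↥(torusU σ J)) :
    torusDetNormOne σ J hJ ⟨w₀ * (t : ↥(unitaryGroupOfForm σ J)) * w₀⁻¹, (weylConj_mem_two σ hJ w₀ hw₀ t).1⟩ =
      torusDetNormOne σ J hJ t := by
  obtain ⟨d, hd⟩ := (mem_torusU_iff _).1 t.2
  apply Subtype.ext
  rw [coe_torusDetNormOne, coe_torusDetNormOne, torusDet_eq_of_glDiagonal_eq σ J _ _ (glDiagonal_rev_eq_weylConj_two σ hJ w₀ hw₀ t hd),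
    torusDet_eq_of_glDiagonal_eq σ J t d hd, Fin.prod_univ_two, Fin.prod_univ_two]
  have h0 : (Fin.rev 0 : Fin 2) = 1 := rfl
  have h1 : (Fin.rev 1 : Fin 2) = 0 := rfl
  rw [h0, h1, mul_comm]

include hw₀ in
/-- **`χ(ʷt) = (wχ)(t)`**: for the character pair `χ = (χ₁, χ₂)` of `T₂` (★ `torusCharPair`, coordinate `0`), conjugation by `w₀` gives the Weyl conjugate
`wχ = (χ̄₁⁻¹, χ₂)` (★ `weylTorusCharPair`). [cite: Rogawski1990, §12.1 p. 171] -/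
theorem torusCharPair_weylConj_two (χ₁ : Rˣ →* ℂˣ) (χ₂ : ↥(normOneUnits σ) →* ℂˣ) (t : ↥(torusU σ J)) :
    torusCharPair σ J hJ 0 χ₁ χ₂ ⟨w₀ * (t : ↥(unitaryGroupOfForm σ J)) * w₀⁻¹, (weylConj_mem_two σ hJ w₀ hw₀ t).1⟩ =
      weylTorusCharPair σ J hJ 0 χ₁ χ₂ t := by
  rw [torusCharPair_apply, weylTorusCharPair_apply, torusEntry_zero_weylConj_two σ hJ w₀ hw₀ t, map_inv,
    torusDetNormOne_weylConj_two σ hJ w₀ hw₀ t]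

end Generic

/-! ### The modulus bookkeeping `‖(ʷt)₀₀‖ = ‖t₀₀‖⁻¹` -/

section Modulus

variable {R : Type*} [CommRing R] [TopologicalSpace R] [IsTopologicalRing R] [LocallyCompactSpace R]
  [MeasurableSpace R] [BorelSpace R] (σ : R →+* R) (hσ : ∀ x, σ (σ x) = x) (hσc : Continuous σ)
  {J : Matrix (Fin 2) (Fin 2) R} (hJ : J = (StdForm.antidiagonal 2).over R)
  (w₀ : ↥(unitaryGroupOfForm σ J)) (hw₀ : ((w₀ : GL (Fin 2) R) : Matrix (Fin 2) (Fin 2) R) = J)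

include hσ hσc hw₀ in
/-- **`‖(ʷt)₀₀‖ = ‖t₀₀‖⁻¹`** (`(ʷt)₀₀ = d₁` and ★ `LineRing.distribHaarChar_torus_two`: `‖d₁‖ = ‖d₀‖⁻¹`; `‖·‖ = ` ★ `unitModulusChar R`).
[cite: Rogawski1990, §1.10 p. 9] -/
theorem unitModulusChar_torusEntry_zero_weylConj_two (t : ↥(torusU σ J)) :
    unitModulusChar R (torusEntry σ J 0 ⟨w₀ * (t : ↥(unitaryGroupOfForm σ J)) * w₀⁻¹, (weylConj_mem_two σ hJ w₀ hw₀ t).1⟩) =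
      (unitModulusChar R (torusEntry σ J 0 t))⁻¹ := by
  obtain ⟨d, hd⟩ := (mem_torusU_iff _).1 t.2
  rw [torusEntry_eq_of_glDiagonal_eq σ J 0 _ _ (glDiagonal_rev_eq_weylConj_two σ hJ w₀ hw₀ t hd),
    torusEntry_eq_of_glDiagonal_eq σ J 0 t d hd]
  exact LineRing.distribHaarChar_torus_two σ hσ hσc hJ t hd

end Modulus

/-! ## §2 The CM instance `U(Φ₂)(L⁺_v)` -/

section CM

open _root_.NumberField _root_.IsDedekindDomain

variable (L : Type) [Field L] [NumberField L] [IsCMField L] (v : HeightOneSpectrum (𝓞 ↥(maximalRealSubfield L)))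
  (w₀ : ↥(unitaryGroupOfForm (conjLocal L (IsCMField.complexConj L) v) (cmLocalForm L 2 v)))
  (hw₀ : Units.val (w₀ : GL (Fin 2) (LocalRing L v)) = cmLocalForm L 2 v)

include hw₀ in
/-- `ʷt ∈ T₂(L⁺_v)` at the CM data (`w₀` with matrix `Φ₂ = cmLocalForm L 2 v`, ★ `u2LocalBruhatDecomposition`). [cite: Rogawski1990, §1.10 p. 9] -/
theorem weylConj_mem_cmTorus_two (t : ↥(torusU (conjLocal L (IsCMField.complexConj L) v) (cmLocalForm L 2 v))) :
    w₀ * (t : ↥(unitaryGroupOfForm (conjLocal L (IsCMField.complexConj L) v) (cmLocalForm L 2 v))) * w₀⁻¹ ∈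
      torusU (conjLocal L (IsCMField.complexConj L) v) (cmLocalForm L 2 v) :=
  (weylConj_mem_two (conjLocal L (IsCMField.complexConj L) v) (cmLocalForm_eq_over L 2 v) w₀ hw₀ t).1

include hw₀ in
/-- `ʷt ∈ B₂(L⁺_v) = (cmBorelTriple L 2 v).P`. [cite: Rogawski1990, §1.10 p. 9] -/
theorem weylConj_mem_cmBorel_two (t : ↥(torusU (conjLocal L (IsCMField.complexConj L) v) (cmLocalForm L 2 v))) :
    w₀ * (t : ↥(unitaryGroupOfForm (conjLocal L (IsCMField.complexConj L) v) (cmLocalForm L 2 v))) * w₀⁻¹ ∈ (cmBorelTriple L 2 v).P :=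
  (weylConj_mem_two (conjLocal L (IsCMField.complexConj L) v) (cmLocalForm_eq_over L 2 v) w₀ hw₀ t).2

include hw₀ in
/-- **`χ(ʷt) = (wχ)(t)` on `T₂(L⁺_v)`** for `χ = torusCharPair … 0 χ₁ χ₂` and `wχ = weylTorusCharPair … 0 χ₁ χ₂` at the CM data. [cite: Rogawski1990, §12.1 p. 171] -/
theorem torusCharPair_cm_weylConj_two (χ₁ : (LocalRing L v)ˣ →* ℂˣ)
    (χ₂ : ↥(normOneUnits (conjLocal L (IsCMField.complexConj L) v)) →* ℂˣ)
    (t : ↥(torusU (conjLocal L (IsCMField.complexConj L) v) (cmLocalForm L 2 v))) :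
    torusCharPair (conjLocal L (IsCMField.complexConj L) v) (cmLocalForm L 2 v) (cmLocalForm_eq_over L 2 v) 0 χ₁ χ₂
        ⟨w₀ * (t : ↥(unitaryGroupOfForm (conjLocal L (IsCMField.complexConj L) v) (cmLocalForm L 2 v))) * w₀⁻¹, weylConj_mem_cmTorus_two L v w₀ hw₀ t⟩ =
      weylTorusCharPair (conjLocal L (IsCMField.complexConj L) v) (cmLocalForm L 2 v) (cmLocalForm_eq_over L 2 v) 0 χ₁ χ₂ t :=
  torusCharPair_weylConj_two (conjLocal L (IsCMField.complexConj L) v) (cmLocalForm_eq_over L 2 v) w₀ hw₀ χ₁ χ₂ t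

include hw₀ in
/-- `proj ⟨ʷt, _⟩ = ⟨ʷt, _⟩` for the Borel triple of `U(Φ₂)(L⁺_v)`. [cite: BernsteinZelevinsky1977, §1.8] -/
theorem proj_cmBorel_weylConj_two (t : ↥(torusU (conjLocal L (IsCMField.complexConj L) v) (cmLocalForm L 2 v))) :
    (cmBorelTriple L 2 v).proj ⟨w₀ * (t : ↥(unitaryGroupOfForm (conjLocal L (IsCMField.complexConj L) v) (cmLocalForm L 2 v))) * w₀⁻¹,
        weylConj_mem_cmBorel_two L v w₀ hw₀ t⟩ =
      ⟨w₀ * (t : ↥(unitaryGroupOfForm (conjLocal L (IsCMField.complexConj L) v) (cmLocalForm L 2 v))) * w₀⁻¹,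
        weylConj_mem_cmTorus_two L v w₀ hw₀ t⟩ :=
  proj_weylConj_two (conjLocal L (IsCMField.complexConj L) v) (cmLocalForm_eq_over L 2 v) w₀ hw₀ t

include hw₀ in
/-- **`‖(ʷt)₀₀‖ = ‖t₀₀‖⁻¹` on `T₂(L⁺_v)`** (`c ⊗ 1` is an isometric involution of `∏_{w∣v} L_w`: ★ `conjLocal_conjLocal_cm`, ★ `continuous_conjLocal`).
[cite: Rogawski1990, §1.10 p. 9] -/
theorem unitModulusChar_torusEntry_zero_cm_weylConj_two [MeasurableSpace (LocalRing L v)] [BorelSpace (LocalRing L v)]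
    (t : ↥(torusU (conjLocal L (IsCMField.complexConj L) v) (cmLocalForm L 2 v))) :
    unitModulusChar (LocalRing L v) (torusEntry (conjLocal L (IsCMField.complexConj L) v) (cmLocalForm L 2 v) 0
        ⟨w₀ * (t : ↥(unitaryGroupOfForm (conjLocal L (IsCMField.complexConj L) v) (cmLocalForm L 2 v))) * w₀⁻¹, weylConj_mem_cmTorus_two L v w₀ hw₀ t⟩) =
      (unitModulusChar (LocalRing L v) (torusEntry (conjLocal L (IsCMField.complexConj L) v) (cmLocalForm L 2 v) 0 t))⁻¹ :=
  unitModulusChar_torusEntry_zero_weylConj_two (conjLocal L (IsCMField.complexConj L) v) (conjLocal_conjLocal_cm L v)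
    (continuous_conjLocal L (IsCMField.complexConj L) v) (cmLocalForm_eq_over L 2 v) w₀ hw₀ t

end CM

end UnitaryGroup

end Literature.NumberTheory.Automorphic

end
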